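import Mathlib.Analysis.Normed.Operator.Compact.FredholmAlternative
import HarnessLib

/-!
# The Fredholm alternative for compact operators: the surjective half (F. Riesz 1918)

Topic `Literature/Analysis/OperatorTheory`. Proofs-layer file (Mathlib only; theorems only, no
definitions, no named facts).

Mathlib's `Mathlib.Analysis.Normed.Operator.Compact.FredholmAlternative` proves, for a compact
operator `T : X →L[𝕜] X` on a Banach space over a nontrivially normed field and `μ ≠ 0`, that
`T - μ • 1` injective ⇒ `T - μ • 1` bijective
(`IsCompactOperator.hasEigenvalue_or_mem_resolventSet`,
`IsCompactOperator.antilipschitz_of_not_hasEigenvalue`). This file supplies the converse half of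
F. Riesz's theorem,

* `injective_of_surjective_of_isCompactOperator` — `T - μ • 1` surjective ⇒ injective
  (for this half `X` need not be complete),

so that injectivity, surjectivity and bijectivity of `T - μ • 1` are all equivalent on a Banach
space (`bijective_iff_injective_of_isCompactOperator`,
`bijective_iff_surjective_of_isCompactOperator`, `injective_iff_surjective_of_isCompactOperator`),
and a non-zero eigenvalue `μ` of a compact operator always has COKERNEL: `T - μ • 1` is not onto
(`not_surjective_of_hasEigenvalue`, `hasEigenvalue_iff_not_surjective`). The last section
transports this to compact perturbations `S` of a linear homeomorphism `J : X ≃L[𝕜] Y` between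
normed spaces (`S - J` compact): `S` surjective ⇒ `S` injective
(`injective_of_surjective_of_isCompactOperator_sub`,
`bijective_iff_surjective_of_isCompactOperator_sub`,
`exists_not_mem_range_of_not_injective_of_isCompactOperator_sub`), the form in which the
Lyapunov–Schmidt reduction at a degenerate zero consumes it (a non-trivial kernel forces a vector
outside the range).

## The argument (Riesz 1918, mirror image of Mathlib's proof with iterated kernels)

Let `S := T - μ • 1` be onto but not one-to-one. The kernels `Nₙ := ker Sⁿ` are closed and
increase STRICTLY: if `S x₁ = 0`, `x₁ ≠ 0` and `g` is a right inverse of `S`, then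
`Sⁿ (gⁿ x₁) = x₁ ≠ 0 = Sⁿ⁺¹ (gⁿ x₁)`. Riesz's lemma (in the shell form
`riesz_lemma_of_norm_lt`, since over a general field vectors cannot be normalised) gives
`fₙ ∈ Nₙ₊₁` with `‖fₙ‖ ≤ R` and `dist (fₙ, Nₙ) ≥ 1`. For `m < n`,
`T fₙ - T fₘ = μ • (fₙ - u)` with `u = μ⁻¹ • (S fₘ + μ • fₘ - S fₙ) ∈ Nₙ`, so
`‖T fₙ - T fₘ‖ ≥ ‖μ‖`: the bounded sequence `(fₙ)` has an image `(T fₙ)` without Cauchy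
subsequences, contradicting the compactness of `T`.

Mathlib search: `hasEigenvalue_or_mem_resolventSet`, `antilipschitz_of_not_hasEigenvalue`,
`hasEigenvalue_iff_mem_spectrum` (the injective ⇒ surjective half and the spectral corollary only;
`lean search 'injective_of_surjective.*Compact|not_surjective_of_hasEigenvalue|iterateKer.*Compact'`
finds nothing). Used: `riesz_lemma_of_norm_lt`, `NormedField.exists_one_lt_norm`,
`IsCompactOperator.image_closedBall_subset_compact`, `IsCompact.tendsto_subseq`,
`Metric.cauchySeq_iff'`, `Module.End.pow_map_zero_of_le`, `ContinuousLinearMap.isClosed_ker`,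
`ContinuousLinearMap.isUnit_iff_bijective`, `spectrum.mem_resolventSet_iff`.

## References

* F. Riesz, *Über lineare Funktionalgleichungen*, Acta Math. 41 (1918) 71–98 (the chains of
  kernels and ranges of `1 - K`).
* M. Reed, B. Simon, *Methods of Modern Mathematical Physics I*, Thm. VI.15 (the Fredholm
  alternative) and its corollary. [ReedSimonI1980]
* H. Brezis, *Functional Analysis, Sobolev Spaces and Partial Differential Equations* (2011),
  Thm. 6.6 (c): `N(I - T) = {0} ⟺ R(I - T) = E` for compact `T`. [Brezis2011]
* T. Tao, *A proof of the Fredholm alternative* (blog, 2011), §2 — the proof Mathlib follows for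
  the other half.
-/

open Filter Topology Module End

namespace Literature.Analysis.OperatorTheory

section Field

variable {𝕜 X : Type*} [NontriviallyNormedField 𝕜] [NormedAddCommGroup X] [NormedSpace 𝕜 X]

/-- **Riesz's strictly increasing chain of kernels.** If a continuous linear endomorphism `S` of
a normed space is onto but not one-to-one, then for `1 < ‖c‖ < R` there are vectors `f n` with
`‖f n‖ ≤ R`, `f n ∈ ker Sⁿ⁺¹` and `‖f n - y‖ ≥ 1` for every `y ∈ ker Sⁿ` (Riesz's lemma in the
shell form `riesz_lemma_of_norm_lt`, applied to the closed proper subspace `ker Sⁿ` of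
`ker Sⁿ⁺¹`; properness because `Sⁿ (gⁿ x₁) = x₁ ≠ 0 = Sⁿ⁺¹ (gⁿ x₁)` for a right inverse `g` of
`S` and `0 ≠ x₁ ∈ ker S`). Mirror image of Mathlib's private `IsCompactOperator.exists_seq`
(iterated ranges). [folklore] -/
private theorem exists_seq_ker {S : X →L[𝕜] X} (hS_surj : (S : X → X).Surjective)
    (hS_not_inj : ¬ (S : X → X).Injective) {c : 𝕜} (hc : 1 < ‖c‖) {R : ℝ} (hR : ‖c‖ < R) :
    ∃ f : ℕ → X, (∀ n, ‖f n‖ ≤ R) ∧ (∀ n, f n ∈ LinearMap.ker ((S : End 𝕜 X) ^ (n + 1))) ∧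
      ∀ n, ∀ y ∈ LinearMap.ker ((S : End 𝕜 X) ^ n), 1 ≤ ‖f n - y‖ := by
  -- the kernels `N n := ker Sⁿ`: closed and increasing
  let N (n : ℕ) : Submodule 𝕜 X := LinearMap.ker ((S : End 𝕜 X) ^ n)
  have hN_closed (n : ℕ) : IsClosed (N n : Set X) := by
    simp only [N]
    rw [← ContinuousLinearMap.coe_pow]
    exact (S ^ n).isClosed_ker
  have hN_mono {m n : ℕ} (h : m ≤ n) {x : X} (hx : x ∈ N m) : x ∈ N n :=
    LinearMap.mem_ker.2 (Module.End.pow_map_zero_of_le h (LinearMap.mem_ker.1 hx))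
  -- a right inverse `g` of `S` and a non-zero `x₁ ∈ ker S`; then `g^[n] x₁ ∈ N (n + 1) ∖ N n`
  obtain ⟨g, hg⟩ := hS_surj.hasRightInverse
  obtain ⟨x₁, hx₁S, hx₁⟩ : ∃ x₁, S x₁ = 0 ∧ x₁ ≠ 0 := by
    by_contra! h
    exact hS_not_inj ((injective_iff_map_eq_zero S).2 h)
  have hpow (n : ℕ) : ((S : End 𝕜 X) ^ n) (g^[n] x₁) = x₁ := by
    rw [Module.End.pow_apply, ContinuousLinearMap.coe_coe]
    exact hg.iterate n x₁
  have hmem (n : ℕ) : g^[n] x₁ ∈ N (n + 1) := by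
    refine LinearMap.mem_ker.2 ?_
    rw [Module.End.iterate_succ', LinearMap.comp_apply, hpow, ContinuousLinearMap.coe_coe, hx₁S]
  have hnot (n : ℕ) : g^[n] x₁ ∉ N n := fun h ↦
    hx₁ ((hpow n).symm.trans (LinearMap.mem_ker.1 h))
  -- Riesz's lemma in the subspace `N (n + 1)` with the closed proper subspace `N n`
  have key (n : ℕ) : ∃ x ∈ N (n + 1), ‖x‖ ≤ R ∧ ∀ y ∈ N n, 1 ≤ ‖x - y‖ := by
    have h₁ : IsClosed ((N n).comap (N (n + 1)).subtype : Set (N (n + 1))) := by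
      simpa using! (hN_closed n).preimage_val
    have h₂ : ∃ x : N (n + 1), x ∉ (N n).comap (N (n + 1)).subtype :=
      ⟨⟨_, hmem n⟩, fun h ↦ hnot n (Submodule.mem_comap.1 h)⟩
    obtain ⟨⟨x, hx⟩, hxR, hxy⟩ := riesz_lemma_of_norm_lt hc hR h₁ h₂
    simp only [Submodule.mem_comap, Submodule.subtype_apply, Subtype.forall] at hxy
    exact ⟨x, hx, hxR, fun y hy ↦ hxy y (hN_mono n.le_succ hy) hy⟩
  choose f hf_mem hf_R hf_far using key
  exact ⟨f, hf_R, hf_mem, hf_far⟩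

variable {T : X →L[𝕜] X} {μ : 𝕜}

/-- **Fredholm alternative, surjective half** (F. Riesz 1918; Reed–Simon I, Thm. VI.15; Brezis,
Thm. 6.6 (c)). If `T` is a compact operator on a normed space over a nontrivially normed field
and `μ ≠ 0`, then `T - μ • 1` surjective ⇒ `T - μ • 1` injective. (Were it not, Riesz's chain
`ker (T - μ)ⁿ` would be strictly increasing and would carry a bounded sequence `fₙ` with
`‖T fₙ - T fₘ‖ ≥ ‖μ‖`, contradicting the compactness of `T`. Completeness of `X` is not needed
for this half.) [cite: Brezis2011, Thm. 6.6] -/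
theorem injective_of_surjective_of_isCompactOperator (hT : IsCompactOperator T) (hμ : μ ≠ 0)
    (hsurj : Function.Surjective (T - μ • 1 : X →L[𝕜] X)) :
    Function.Injective (T - μ • 1 : X →L[𝕜] X) := by
  by_contra hinj
  set S : X →L[𝕜] X := T - μ • 1 with hS_def
  have hSx (x : X) : S x = T x - μ • x := by simp [hS_def]
  -- Riesz's sequence: `f n ∈ ker Sⁿ⁺¹`, `‖f n‖ ≤ ‖c‖ + 1`, at distance `≥ 1` from `ker Sⁿ`
  obtain ⟨c, hc⟩ := NormedField.exists_one_lt_norm 𝕜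
  obtain ⟨f, hf_R, hf_mem, hf_far⟩ :=
    exists_seq_ker hsurj hinj hc (R := ‖c‖ + 1) (by simp)
  have hmono {m n : ℕ} (h : m ≤ n) {x : X} (hx : x ∈ LinearMap.ker ((S : End 𝕜 X) ^ m)) :
      x ∈ LinearMap.ker ((S : End 𝕜 X) ^ n) :=
    LinearMap.mem_ker.2 (Module.End.pow_map_zero_of_le h (LinearMap.mem_ker.1 hx))
  have hS_mem {m : ℕ} {x : X} (hx : x ∈ LinearMap.ker ((S : End 𝕜 X) ^ (m + 1))) :
      S x ∈ LinearMap.ker ((S : End 𝕜 X) ^ m) := by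
    refine LinearMap.mem_ker.2 ?_
    have hx' := LinearMap.mem_ker.1 hx
    rwa [Module.End.iterate_succ, LinearMap.comp_apply, ContinuousLinearMap.coe_coe] at hx'
  -- the images `T (f n)` are `‖μ‖`-separated
  have hsep {m n : ℕ} (hmn : m < n) : ‖μ‖ ≤ ‖T (f n) - T (f m)‖ := by
    let u : X := μ⁻¹ • (S (f m) + μ • f m - S (f n))
    have hu : μ • (f n - u) = T (f n) - T (f m) := by
      simp only [u, smul_sub, smul_inv_smul₀ hμ, hSx]
      abel
    have hu_mem : u ∈ LinearMap.ker ((S : End 𝕜 X) ^ n) := by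
      refine Submodule.smul_mem _ _ (Submodule.sub_mem _ (Submodule.add_mem _ ?_ ?_) ?_)
      · exact hmono hmn.le (hS_mem (hf_mem m))
      · exact Submodule.smul_mem _ _ (hmono (Nat.succ_le_of_lt hmn) (hf_mem m))
      · exact hS_mem (hf_mem n)
    calc ‖μ‖ = ‖μ‖ * 1 := (mul_one _).symm
      _ ≤ ‖μ‖ * ‖f n - u‖ := by gcongr; exact hf_far n u hu_mem
      _ = ‖μ • (f n - u)‖ := (norm_smul _ _).symm
      _ = ‖T (f n) - T (f m)‖ := by rw [hu]
  -- but `(f n)` is bounded, so `(T (f n))` lies in a compact set and has a Cauchy subsequence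
  obtain ⟨K, hK, hK'⟩ := hT.image_closedBall_subset_compact (‖c‖ + 1)
  obtain ⟨y, -, ψ, hψ, hψy⟩ := hK.tendsto_subseq (x := fun n ↦ T (f n))
    (fun n ↦ hK' ⟨f n, by simp [hf_R], rfl⟩)
  replace hψy := hψy.cauchySeq
  rw [Metric.cauchySeq_iff'] at hψy
  obtain ⟨N, hN⟩ := hψy ‖μ‖ (norm_pos_iff.2 hμ)
  have hlt : ‖T (f (ψ (N + 1))) - T (f (ψ N))‖ < ‖μ‖ := by
    simpa [dist_eq_norm] using hN (N + 1) N.le_succ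
  exact hlt.not_ge (hsep (hψ N.lt_succ_self))

/-- **Fredholm alternative** for a compact operator `T` and `μ ≠ 0`: `T - μ • 1` is bijective
iff it is surjective (`injective_of_surjective_of_isCompactOperator`; no completeness needed).
[folklore] -/
theorem bijective_iff_surjective_of_isCompactOperator (hT : IsCompactOperator T) (hμ : μ ≠ 0) :
    Function.Bijective (T - μ • 1 : X →L[𝕜] X) ↔
      Function.Surjective (T - μ • 1 : X →L[𝕜] X) :=
  ⟨fun h ↦ h.2, fun h ↦ ⟨injective_of_surjective_of_isCompactOperator hT hμ h, h⟩⟩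

/-- A non-zero eigenvalue `μ` of a compact operator `T` on a normed space has cokernel:
`T - μ • 1` is NOT surjective (contrapositive of `injective_of_surjective_of_isCompactOperator`:
an eigenvector is a non-zero vector of the kernel). [folklore] -/
theorem not_surjective_of_hasEigenvalue (hT : IsCompactOperator T) (hμ : μ ≠ 0)
    (h : Module.End.HasEigenvalue (T : Module.End 𝕜 X) μ) :
    ¬ Function.Surjective (T - μ • 1 : X →L[𝕜] X) := by
  intro hsurj
  obtain ⟨v, hv⟩ := h.exists_hasEigenvector
  refine hv.2 (injective_of_surjective_of_isCompactOperator hT hμ hsurj ?_)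
  have h1 : T v = μ • v := hv.apply_eq_smul
  rw [map_zero, sub_apply, smul_apply, one_apply_eq_self, h1, sub_self]

variable [CompleteSpace X]

/-- **Fredholm alternative** for a compact operator `T` on a Banach space and `μ ≠ 0`:
`T - μ • 1` is bijective iff it is injective (Mathlib's half: no eigenvalue `μ` ⇒ `μ` in the
resolvent set, by `IsCompactOperator.hasEigenvalue_or_mem_resolventSet` and the open mapping
theorem). [folklore] -/
theorem bijective_iff_injective_of_isCompactOperator (hT : IsCompactOperator T) (hμ : μ ≠ 0) :
    Function.Bijective (T - μ • 1 : X →L[𝕜] X) ↔ Function.Injective (T - μ • 1 : X →L[𝕜] X) := by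
  refine ⟨fun h ↦ h.1, fun hinj ↦ ?_⟩
  have hnot : ¬ HasEigenvalue (T : End 𝕜 X) μ := by
    intro h
    obtain ⟨v, hv⟩ := h.exists_hasEigenvector
    refine hv.2 (hinj ?_)
    have h1 : T v = μ • v := hv.apply_eq_smul
    rw [map_zero, sub_apply, smul_apply, one_apply_eq_self, h1, sub_self]
  have hres := (IsCompactOperator.hasEigenvalue_or_mem_resolventSet hT hμ).resolve_left hnot
  rwa [spectrum.mem_resolventSet_iff, ← IsUnit.neg_iff, neg_sub, Algebra.algebraMap_eq_smul_one,
    ContinuousLinearMap.isUnit_iff_bijective] at hres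

/-- **Fredholm alternative** for a compact operator `T` on a Banach space and `μ ≠ 0`:
`T - μ • 1` is injective iff it is surjective (Riesz 1918; Brezis, Thm. 6.6 (c)).
[cite: Brezis2011, Thm. 6.6] -/
theorem injective_iff_surjective_of_isCompactOperator (hT : IsCompactOperator T) (hμ : μ ≠ 0) :
    Function.Injective (T - μ • 1 : X →L[𝕜] X) ↔
      Function.Surjective (T - μ • 1 : X →L[𝕜] X) := by
  rw [← bijective_iff_injective_of_isCompactOperator hT hμ,
    bijective_iff_surjective_of_isCompactOperator hT hμ]

/-- For a compact operator `T` on a Banach space and `μ ≠ 0`: `μ` is an eigenvalue of `T` iff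
`T - μ • 1` is not surjective (`not_surjective_of_hasEigenvalue` and Mathlib's
`hasEigenvalue_or_mem_resolventSet`). [folklore] -/
theorem hasEigenvalue_iff_not_surjective (hT : IsCompactOperator T) (hμ : μ ≠ 0) :
    Module.End.HasEigenvalue (T : Module.End 𝕜 X) μ ↔
      ¬ Function.Surjective (T - μ • 1 : X →L[𝕜] X) := by
  refine ⟨not_surjective_of_hasEigenvalue hT hμ, fun h ↦ ?_⟩
  by_contra hnot
  have hres := (IsCompactOperator.hasEigenvalue_or_mem_resolventSet hT hμ).resolve_left hnot
  rw [spectrum.mem_resolventSet_iff, ← IsUnit.neg_iff, neg_sub, Algebra.algebraMap_eq_smul_one,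
    ContinuousLinearMap.isUnit_iff_bijective] at hres
  exact h hres.2

end Field

/-! ### Compact perturbations of a linear homeomorphism -/

section Perturbation

variable {𝕜 X Y : Type*} [NontriviallyNormedField 𝕜] [NormedAddCommGroup X] [NormedSpace 𝕜 X]
  [NormedAddCommGroup Y] [NormedSpace 𝕜 Y]

/-- **Fredholm alternative for a compact perturbation of an isomorphism, surjective half**: if
`S - J` is compact for a linear homeomorphism `J : X ≃L Y` of normed spaces, then `S` surjective
⇒ `S` injective. (`S = J ∘ (1 + K₀)` with `K₀ = J⁻¹ (S - J)` compact; `1 + K₀ = K₀ - (-1) • 1`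
is onto, hence one-to-one by `injective_of_surjective_of_isCompactOperator` at `μ = -1`; no
completeness is needed for this direction.) [folklore] -/
theorem injective_of_surjective_of_isCompactOperator_sub (S : X →L[𝕜] Y) (J : X ≃L[𝕜] Y)
    (hK : IsCompactOperator (S - (J : X →L[𝕜] Y) : X →L[𝕜] Y)) (hsurj : Function.Surjective S) :
    Function.Injective S := by
  set K₀ : X →L[𝕜] X := (J.symm : Y →L[𝕜] X) ∘L (S - (J : X →L[𝕜] Y)) with hK₀
  have hK₀c : IsCompactOperator K₀ := hK.clm_comp (J.symm : Y →L[𝕜] X)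
  have hS : ∀ x, S x = J ((K₀ - (-1 : 𝕜) • 1) x) := by
    intro x
    simp [hK₀]
  have h1surj : Function.Surjective (K₀ - (-1 : 𝕜) • 1 : X →L[𝕜] X) := by
    intro y
    obtain ⟨x, hx⟩ := hsurj (J y)
    refine ⟨x, J.injective ?_⟩
    rw [← hS, hx]
  have h1inj := injective_of_surjective_of_isCompactOperator hK₀c (μ := (-1 : 𝕜))
    (neg_ne_zero.2 one_ne_zero) h1surj
  intro x y hxy
  apply h1inj
  apply J.injective
  rw [← hS, ← hS, hxy]

/-- **Fredholm alternative for a compact perturbation of an isomorphism**: if `S - J` is compact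
for a linear homeomorphism `J : X ≃L Y` of normed spaces, then `S` is bijective iff it is
surjective (`injective_of_surjective_of_isCompactOperator_sub`). [folklore] -/
theorem bijective_iff_surjective_of_isCompactOperator_sub (S : X →L[𝕜] Y) (J : X ≃L[𝕜] Y)
    (hK : IsCompactOperator (S - (J : X →L[𝕜] Y) : X →L[𝕜] Y)) :
    Function.Bijective S ↔ Function.Surjective S :=
  ⟨fun h ↦ h.2, fun h ↦ ⟨injective_of_surjective_of_isCompactOperator_sub S J hK h, h⟩⟩

/-- A compact perturbation `S` of a linear homeomorphism `J : X ≃L Y` of normed spaces with a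
non-trivial kernel has cokernel: some `e : Y` lies outside the range of `S` (the "visible
direction" of the Lyapunov–Schmidt reduction at a degenerate zero). [folklore] -/
theorem exists_not_mem_range_of_not_injective_of_isCompactOperator_sub (S : X →L[𝕜] Y)
    (J : X ≃L[𝕜] Y) (hK : IsCompactOperator (S - (J : X →L[𝕜] Y) : X →L[𝕜] Y))
    (hS : ¬ Function.Injective S) : ∃ e : Y, ∀ x, S x ≠ e := by
  by_contra! h
  exact hS (injective_of_surjective_of_isCompactOperator_sub S J hK fun e ↦ h e)

end Perturbation

end Literature.Analysis.OperatorTheory
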